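import Mathlib
import HarnessLib

/-!
# Stub C `stub_adSurjectiveOfSplitForm` (line `birth`, crux `AdjointSeedFromDuality`, stmt-Langlands-16780)

The exceptional isomorphism `SO₃ = Ad(GL₂)` (surjectivity half) over a field with `2 ≠ 0`, in the
split model, and the normal form of a symmetric invertible `3 × 3` matrix over an algebraically
closed field.  Coordinates: `v : Fin 3 → k` names `X_v := !![v 1, v 0; v 2, -v 1]` (basis `E, H, F`
of `sl₂`); the trace form `tr(X_v X_w) = vᵀ J w` has Gram matrix `J := !![0, 0, 1; 0, 2, 0; 1, 0, 0]`,
and `[X_v, X_w] = X_{br(v,w)}`, `br(v,w) = (2(v₁w₀ − v₀w₁), v₀w₂ − v₂w₀, 2(v₂w₁ − v₁w₂))`.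
For `N` with `Nᵀ J N = J`, `det N = 1`: the universal identity `J·br(Nv, Nw) = (adj N)ᵀ J·br(v, w)`
and `(adj N)ᵀ J = J N` give `br(Nv, Nw) = N br(v, w)`; with `X_v X_w + X_w X_v = (vᵀJw) • 1` the
matrices `E' = X_{N e₀}`, `F' = X_{N e₂}`, `H' = X_{N e₁}` satisfy `E'² = F'² = 0`, `E'F' + F'E' = 1`,
`E'F' − F'E' = H'`, so `P := E'F'` is a nonzero idempotent and, for a column `u` with `P u ≠ 0`,
`g := [P u | F' u]` is invertible with `g E = E' g`, `g H = H' g`, `g F = F' g`, i.e. `g X_v g⁻¹ = X_{Nv}`.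
-/

set_option linter.dupNamespace false -- `Summit.Langlands.Langlands` is the mandated namespace

namespace Summit.Langlands.Langlands.Cruxes.AdjointSeedFromDuality.Birth

open scoped MatrixGroups
open Matrix

section SplitSO3

variable {k : Type} [Field k]

/-- `det J = -2` for the split Gram matrix `J`. -/
private theorem det_J : (!![0, 0, 1; 0, 2, 0; 1, 0, 0] : Matrix (Fin 3) (Fin 3) k).det = -2 := by
  simp [Matrix.det_fin_three]

/-- The bracket in coordinates: `[X_v, X_w] = X_{br(v,w)}`. -/
private theorem bracket_eq (v w : Fin 3 → k) :
    !![v 1, v 0; v 2, -v 1] * !![w 1, w 0; w 2, -w 1] - !![w 1, w 0; w 2, -w 1] * !![v 1, v 0; v 2, -v 1] =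
      !![v 0 * w 2 - v 2 * w 0, 2 * (v 1 * w 0 - v 0 * w 1);
         2 * (v 2 * w 1 - v 1 * w 2), -(v 0 * w 2 - v 2 * w 0)] := by
  ext i j; fin_cases i <;> fin_cases j <;> simp <;> ring

/-- The anticommutator identity on `sl₂`: `X_v X_w + X_w X_v = (vᵀ J w) • 1`. -/
private theorem anticomm_eq (v w : Fin 3 → k) :
    !![v 1, v 0; v 2, -v 1] * !![w 1, w 0; w 2, -w 1] + !![w 1, w 0; w 2, -w 1] * !![v 1, v 0; v 2, -v 1] =
      (2 * (v 1 * w 1) + v 0 * w 2 + v 2 * w 0) • (1 : Matrix (Fin 2) (Fin 2) k) := by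
  ext i j; fin_cases i <;> fin_cases j <;> simp <;> ring

/-- The trace form in coordinates: `vᵀ J w`. -/
private theorem form_eq (v w : Fin 3 → k) :
    v ⬝ᵥ ((!![0, 0, 1; 0, 2, 0; 1, 0, 0] : Matrix (Fin 3) (Fin 3) k).mulVec w) =
      2 * (v 1 * w 1) + v 0 * w 2 + v 2 * w 0 := by
  simp [Matrix.mulVec, dotProduct, Fin.sum_univ_three]
  ring

/-- **Universal cofactor identity**: `J · br(Nv, Nw) = (adj N)ᵀ J · br(v, w)` for every `N`. -/
private theorem J_mulVec_bracket (N : Matrix (Fin 3) (Fin 3) k) (v w : Fin 3 → k) :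
    (!![0, 0, 1; 0, 2, 0; 1, 0, 0] : Matrix (Fin 3) (Fin 3) k).mulVec
        ![2 * ((N.mulVec v) 1 * (N.mulVec w) 0 - (N.mulVec v) 0 * (N.mulVec w) 1),
          (N.mulVec v) 0 * (N.mulVec w) 2 - (N.mulVec v) 2 * (N.mulVec w) 0,
          2 * ((N.mulVec v) 2 * (N.mulVec w) 1 - (N.mulVec v) 1 * (N.mulVec w) 2)] =
      (N.adjugate.transpose * !![0, 0, 1; 0, 2, 0; 1, 0, 0]).mulVec
        ![2 * (v 1 * w 0 - v 0 * w 1), v 0 * w 2 - v 2 * w 0, 2 * (v 2 * w 1 - v 1 * w 2)] := by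
  rw [Matrix.adjugate_fin_three]
  ext i; fin_cases i <;>
    simp [Matrix.mulVec, dotProduct, Fin.sum_univ_three, Matrix.mul_apply] <;> ring

variable {N : Matrix (Fin 3) (Fin 3) k}

/-- For `N ∈ SO(J)`: `(adj N)ᵀ J = J N` (since `adj N = N⁻¹` and `Nᵀ J N = J`). -/
private theorem adjugate_transpose_mul_J
    (hN : N.transpose * !![0, 0, 1; 0, 2, 0; 1, 0, 0] * N = !![0, 0, 1; 0, 2, 0; 1, 0, 0])
    (hdet : N.det = 1) :
    N.adjugate.transpose * (!![0, 0, 1; 0, 2, 0; 1, 0, 0] : Matrix (Fin 3) (Fin 3) k) =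
      !![0, 0, 1; 0, 2, 0; 1, 0, 0] * N := by
  have h1 : N * N.adjugate = 1 := by rw [Matrix.mul_adjugate, hdet, one_smul]
  have h1t : N.adjugate.transpose * N.transpose = 1 := by
    rw [← Matrix.transpose_mul, h1, Matrix.transpose_one]
  calc N.adjugate.transpose * (!![0, 0, 1; 0, 2, 0; 1, 0, 0] : Matrix (Fin 3) (Fin 3) k)
      = N.adjugate.transpose * (N.transpose * !![0, 0, 1; 0, 2, 0; 1, 0, 0] * N) := by rw [hN]
    _ = N.adjugate.transpose * N.transpose * !![0, 0, 1; 0, 2, 0; 1, 0, 0] * N := by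
        simp only [Matrix.mul_assoc]
    _ = !![0, 0, 1; 0, 2, 0; 1, 0, 0] * N := by rw [h1t, Matrix.one_mul]

/-- For `N ∈ O(J)`: the trace form is preserved, `(Nv)ᵀ J (Nw) = vᵀ J w`. -/
private theorem form_pres
    (hN : N.transpose * !![0, 0, 1; 0, 2, 0; 1, 0, 0] * N = !![0, 0, 1; 0, 2, 0; 1, 0, 0])
    (v w : Fin 3 → k) :
    2 * ((N.mulVec v) 1 * (N.mulVec w) 1) + (N.mulVec v) 0 * (N.mulVec w) 2 +
        (N.mulVec v) 2 * (N.mulVec w) 0 =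
      2 * (v 1 * w 1) + v 0 * w 2 + v 2 * w 0 := by
  rw [← form_eq, ← form_eq, Matrix.mulVec_mulVec, ← Matrix.vecMul_transpose,
    Matrix.dotProduct_mulVec, Matrix.vecMul_vecMul, ← Matrix.dotProduct_mulVec, ← Matrix.mul_assoc,
    hN]

/-- For `N ∈ SO(J)` (and `2 ≠ 0`): the bracket is preserved, `br(Nv, Nw) = N br(v, w)`. -/
private theorem bracket_pres (h2 : (2 : k) ≠ 0)
    (hN : N.transpose * !![0, 0, 1; 0, 2, 0; 1, 0, 0] * N = !![0, 0, 1; 0, 2, 0; 1, 0, 0])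
    (hdet : N.det = 1) (v w : Fin 3 → k) :
    ![2 * ((N.mulVec v) 1 * (N.mulVec w) 0 - (N.mulVec v) 0 * (N.mulVec w) 1),
      (N.mulVec v) 0 * (N.mulVec w) 2 - (N.mulVec v) 2 * (N.mulVec w) 0,
      2 * ((N.mulVec v) 2 * (N.mulVec w) 1 - (N.mulVec v) 1 * (N.mulVec w) 2)] =
      N.mulVec ![2 * (v 1 * w 0 - v 0 * w 1), v 0 * w 2 - v 2 * w 0, 2 * (v 2 * w 1 - v 1 * w 2)] := by
  have key := J_mulVec_bracket N v w
  rw [adjugate_transpose_mul_J hN hdet, ← Matrix.mulVec_mulVec] at key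
  have hJ : IsUnit (!![0, 0, 1; 0, 2, 0; 1, 0, 0] : Matrix (Fin 3) (Fin 3) k) := by
    rw [Matrix.isUnit_iff_isUnit_det, det_J]
    exact (neg_ne_zero.mpr h2).isUnit
  exact Matrix.mulVec_injective_iff_isUnit.mpr hJ key

/-- Auxiliary products with the column matrices `U₀ = u ⊗ (1,0)`, `U₁ = u ⊗ (0,1)`. -/
private theorem vecMulVec_aux (u : Fin 2 → k) :
    Matrix.vecMulVec u ![1, 0] * !![(0 : k), 1; 0, 0] = Matrix.vecMulVec u ![0, 1] ∧
    Matrix.vecMulVec u ![0, 1] * !![(0 : k), 1; 0, 0] = 0 ∧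
    Matrix.vecMulVec u ![1, 0] * !![(0 : k), 0; 1, 0] = 0 ∧
    Matrix.vecMulVec u ![0, 1] * !![(0 : k), 0; 1, 0] = Matrix.vecMulVec u ![1, 0] ∧
    Matrix.vecMulVec u ![1, 0] * !![(1 : k), 0; 0, -1] = Matrix.vecMulVec u ![1, 0] ∧
    Matrix.vecMulVec u ![0, 1] * !![(1 : k), 0; 0, -1] = -Matrix.vecMulVec u ![0, 1] := by
  refine ⟨?_, ?_, ?_, ?_, ?_, ?_⟩ <;>
  · ext a b; fin_cases b <;> simp [Matrix.vecMulVec_apply, Matrix.mul_apply, Fin.sum_univ_two]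

/-- `(u ⊗ w) x = (w ⬝ x) u`. -/
private theorem vecMulVec_mulVec_eq (u w x : Fin 2 → k) :
    (Matrix.vecMulVec u w).mulVec x = (w ⬝ᵥ x) • u := by
  ext a
  simp [Matrix.vecMulVec_apply, Matrix.mulVec, dotProduct, Fin.sum_univ_two]
  ring

/-- Decomposition of `X_v` in the basis `E, H, F`. -/
private theorem X_decomp (v : Fin 3 → k) :
    (!![v 1, v 0; v 2, -v 1] : Matrix (Fin 2) (Fin 2) k) =
      v 0 • !![(0 : k), 1; 0, 0] + v 1 • !![(1 : k), 0; 0, -1] + v 2 • !![(0 : k), 0; 1, 0] := by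
  ext a b; fin_cases a <;> fin_cases b <;> simp

/-- Decomposition of `X_{Nv}` in the images `X_{N e₀}, X_{N e₁}, X_{N e₂}`. -/
private theorem X_mulVec_decomp (N : Matrix (Fin 3) (Fin 3) k) (v : Fin 3 → k) :
    (!![(N.mulVec v) 1, (N.mulVec v) 0; (N.mulVec v) 2, -(N.mulVec v) 1] :
        Matrix (Fin 2) (Fin 2) k) =
      v 0 • !![(N.mulVec ![1, 0, 0]) 1, (N.mulVec ![1, 0, 0]) 0;
              (N.mulVec ![1, 0, 0]) 2, -(N.mulVec ![1, 0, 0]) 1] +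
      v 1 • !![(N.mulVec ![0, 1, 0]) 1, (N.mulVec ![0, 1, 0]) 0;
              (N.mulVec ![0, 1, 0]) 2, -(N.mulVec ![0, 1, 0]) 1] +
      v 2 • !![(N.mulVec ![0, 0, 1]) 1, (N.mulVec ![0, 0, 1]) 0;
              (N.mulVec ![0, 0, 1]) 2, -(N.mulVec ![0, 0, 1]) 1] := by
  ext a b; fin_cases a <;> fin_cases b <;>
    simp [Matrix.mulVec, dotProduct, Fin.sum_univ_three] <;> ring

/-- **`SO(J) ⊆ Ad(GL₂)`.**  For `N` with `Nᵀ J N = J` and `det N = 1` (`2 ≠ 0`) there is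
`g ∈ GL₂(k)` with `g X_v g⁻¹ = X_{Nv}` for all `v`. -/
theorem exists_conj_eq_of_mem_SO (h2 : (2 : k) ≠ 0)
    (hN : N.transpose * !![0, 0, 1; 0, 2, 0; 1, 0, 0] * N = !![0, 0, 1; 0, 2, 0; 1, 0, 0])
    (hdet : N.det = 1) :
    ∃ g : GL (Fin 2) k, ∀ v : Fin 3 → k,
      (g : Matrix (Fin 2) (Fin 2) k) * !![v 1, v 0; v 2, -v 1] *
          ((g⁻¹ : GL (Fin 2) k) : Matrix (Fin 2) (Fin 2) k) =
        !![(N.mulVec v) 1, (N.mulVec v) 0; (N.mulVec v) 2, -(N.mulVec v) 1] := by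
  set e₀ : Fin 3 → k := ![1, 0, 0] with he₀
  set e₁ : Fin 3 → k := ![0, 1, 0] with he₁
  set e₂ : Fin 3 → k := ![0, 0, 1] with he₂
  set E : Matrix (Fin 2) (Fin 2) k := !![0, 1; 0, 0] with hE
  set H : Matrix (Fin 2) (Fin 2) k := !![1, 0; 0, -1] with hH
  set F : Matrix (Fin 2) (Fin 2) k := !![0, 0; 1, 0] with hF
  set E' : Matrix (Fin 2) (Fin 2) k :=
    !![(N.mulVec e₀) 1, (N.mulVec e₀) 0; (N.mulVec e₀) 2, -(N.mulVec e₀) 1] with hE'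
  set H' : Matrix (Fin 2) (Fin 2) k :=
    !![(N.mulVec e₁) 1, (N.mulVec e₁) 0; (N.mulVec e₁) 2, -(N.mulVec e₁) 1] with hH'
  set F' : Matrix (Fin 2) (Fin 2) k :=
    !![(N.mulVec e₂) 1, (N.mulVec e₂) 0; (N.mulVec e₂) 2, -(N.mulVec e₂) 1] with hF'
  -- relations from the preservation of the trace form
  have two_smul_eq_zero : ∀ M : Matrix (Fin 2) (Fin 2) k, M + M = 0 → M = 0 := by
    intro M hM
    have h' : (2 : k) • M = 0 := by rw [two_smul]; exact hM
    exact (smul_eq_zero.mp h').resolve_left h2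
  have hEE : E' * E' = 0 := by
    apply two_smul_eq_zero
    have h := anticomm_eq (N.mulVec e₀) (N.mulVec e₀)
    rw [form_pres hN, ← hE'] at h
    simpa [he₀] using h
  have hFF : F' * F' = 0 := by
    apply two_smul_eq_zero
    have h := anticomm_eq (N.mulVec e₂) (N.mulVec e₂)
    rw [form_pres hN, ← hF'] at h
    simpa [he₂] using h
  have hEF : E' * F' + F' * E' = 1 := by
    have h := anticomm_eq (N.mulVec e₀) (N.mulVec e₂)
    rw [form_pres hN, ← hE', ← hF'] at h
    simpa [he₀, he₂] using h
  -- the one relation from bracket preservation: `[E', F'] = H'`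
  have hEFH : E' * F' - F' * E' = H' := by
    have hb := bracket_pres h2 hN hdet e₀ e₂
    have hv : (![2 * (e₀ 1 * e₂ 0 - e₀ 0 * e₂ 1), e₀ 0 * e₂ 2 - e₀ 2 * e₂ 0,
        2 * (e₀ 2 * e₂ 1 - e₀ 1 * e₂ 2)] : Fin 3 → k) = e₁ := by
      ext i; fin_cases i <;> simp [e₀, e₁, e₂]
    rw [hv] at hb
    have h0 := congr_fun hb 0
    have h1 := congr_fun hb 1
    have h2' := congr_fun hb 2
    simp only [Matrix.cons_val_zero, Matrix.cons_val_one, Matrix.head_cons,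
      Matrix.cons_val_two, Matrix.tail_cons] at h0 h1 h2'
    rw [hE', hF', bracket_eq, hH', ← h0, ← h1, ← h2']
  -- the matrix units
  set P : Matrix (Fin 2) (Fin 2) k := E' * F' with hP
  have hS : F' * E' = 1 - P := by rw [← hEF]; abel
  have hPP : P * P = P := by
    calc P * P = E' * (F' * E') * F' := by simp only [hP, Matrix.mul_assoc]
      _ = E' * F' - (E' * E') * (F' * F') := by
          rw [hS, hP]
          noncomm_ring
      _ = P := by rw [hEE, Matrix.zero_mul, sub_zero, hP]
  have hEP : E' * P = 0 := by rw [hP, ← Matrix.mul_assoc, hEE, Matrix.zero_mul]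
  have hPF : P * F' = 0 := by rw [hP, Matrix.mul_assoc, hFF, Matrix.mul_zero]
  have hFP : F' * P = F' := by
    calc F' * P = (F' * E') * F' := by rw [hP, Matrix.mul_assoc]
      _ = F' - E' * (F' * F') := by rw [hS, Matrix.sub_mul, Matrix.one_mul, Matrix.mul_assoc]
      _ = F' := by rw [hFF, Matrix.mul_zero, sub_zero]
  have hH'P : H' = P - (1 - P) := by rw [← hEFH, hS]
  have hPne : P ≠ 0 := by
    intro hP0
    have h1 : F' * E' = 1 := by rw [hS, hP0, sub_zero]
    have : (F' * E') * (F' * E') = F' * P * E' := by simp only [hP, Matrix.mul_assoc]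
    rw [h1, Matrix.mul_one, hP0, Matrix.mul_zero, Matrix.zero_mul] at this
    exact one_ne_zero this
  -- a nonzero column `P u` of `P`
  obtain ⟨i, j, hij⟩ : ∃ i j, P i j ≠ 0 := by
    by_contra h
    apply hPne
    ext i' j'
    by_contra hij
    exact h ⟨i', j', hij⟩
  set u : Fin 2 → k := Pi.single j 1 with hu
  have hPu : P.mulVec u ≠ 0 := by
    intro h
    apply hij
    have := congr_fun h i
    simpa [hu, Matrix.mulVec, dotProduct, Pi.single_apply, Fin.sum_univ_two] using this
  -- the conjugating matrix `g = [P u | F' u] = P U₀ + F' U₁`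
  set U₀ : Matrix (Fin 2) (Fin 2) k := Matrix.vecMulVec u ![1, 0] with hU₀
  set U₁ : Matrix (Fin 2) (Fin 2) k := Matrix.vecMulVec u ![0, 1] with hU₁
  obtain ⟨hU0E, hU1E, hU0F, hU1F, hU0H, hU1H⟩ := vecMulVec_aux u
  set gm : Matrix (Fin 2) (Fin 2) k := P * U₀ + F' * U₁ with hgm
  have hgE : gm * E = E' * gm := by
    calc gm * E = P * (U₀ * E) + F' * (U₁ * E) := by
            simp only [hgm, Matrix.add_mul, Matrix.mul_assoc]
      _ = P * U₁ := by rw [hU0E, hU1E, Matrix.mul_zero, add_zero]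
      _ = (E' * P) * U₀ + (E' * F') * U₁ := by rw [hEP, Matrix.zero_mul, zero_add]
      _ = E' * gm := by simp only [hgm, Matrix.mul_add, Matrix.mul_assoc]
  have hgF : gm * F = F' * gm := by
    calc gm * F = P * (U₀ * F) + F' * (U₁ * F) := by
            simp only [hgm, Matrix.add_mul, Matrix.mul_assoc]
      _ = F' * U₀ := by rw [hU0F, hU1F, Matrix.mul_zero, zero_add]
      _ = (F' * P) * U₀ + (F' * F') * U₁ := by rw [hFP, hFF, Matrix.zero_mul, add_zero]
      _ = F' * gm := by simp only [hgm, Matrix.mul_add, Matrix.mul_assoc]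
  have hgH : gm * H = H' * gm := by
    calc gm * H = P * (U₀ * H) + F' * (U₁ * H) := by
            simp only [hgm, Matrix.add_mul, Matrix.mul_assoc]
      _ = P * U₀ - F' * U₁ := by rw [hU0H, hU1H, Matrix.mul_neg, sub_eq_add_neg]
      _ = (P * P) * U₀ + (P * F') * U₁ - ((1 - P) * P) * U₀ - ((1 - P) * F') * U₁ := by
            rw [hPP, hPF, Matrix.sub_mul, Matrix.one_mul, hPP, sub_self, Matrix.sub_mul,
              Matrix.one_mul, hPF, sub_zero, Matrix.zero_mul, add_zero, Matrix.zero_mul, sub_zero]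
      _ = H' * gm := by
            rw [hH'P]
            simp only [hgm, Matrix.mul_add, Matrix.sub_mul, Matrix.mul_assoc]
            abel
  -- `g` is invertible
  have hPg : P * gm = P * U₀ := by
    calc P * gm = (P * P) * U₀ + (P * F') * U₁ := by
            simp only [hgm, Matrix.mul_add, Matrix.mul_assoc]
      _ = P * U₀ := by rw [hPP, hPF, Matrix.zero_mul, add_zero]
  have hEg : E' * gm = P * U₁ := by
    calc E' * gm = (E' * P) * U₀ + (E' * F') * U₁ := by
            simp only [hgm, Matrix.mul_add, Matrix.mul_assoc]
      _ = P * U₁ := by rw [hEP, Matrix.zero_mul, zero_add]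
  have hdetg : gm.det ≠ 0 := by
    intro h0
    obtain ⟨x, hx, hgx⟩ := Matrix.exists_mulVec_eq_zero_iff.mpr h0
    have hx0 : x 0 = 0 := by
      have : (P * gm).mulVec x = 0 := by rw [← Matrix.mulVec_mulVec, hgx, Matrix.mulVec_zero]
      rw [hPg, ← Matrix.mulVec_mulVec, hU₀, vecMulVec_mulVec_eq, Matrix.mulVec_smul] at this
      have h' := (smul_eq_zero.mp this).resolve_right hPu
      simpa [dotProduct, Fin.sum_univ_two] using h'
    have hx1 : x 1 = 0 := by
      have : (E' * gm).mulVec x = 0 := by rw [← Matrix.mulVec_mulVec, hgx, Matrix.mulVec_zero]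
      rw [hEg, ← Matrix.mulVec_mulVec, hU₁, vecMulVec_mulVec_eq, Matrix.mulVec_smul] at this
      have h' := (smul_eq_zero.mp this).resolve_right hPu
      simpa [dotProduct, Fin.sum_univ_two] using h'
    apply hx
    ext l; fin_cases l
    · exact hx0
    · exact hx1
  -- conclusion
  refine ⟨Matrix.GeneralLinearGroup.mkOfDetNeZero gm hdetg, fun v => ?_⟩
  have hcomm : gm * !![v 1, v 0; v 2, -v 1] =
      !![(N.mulVec v) 1, (N.mulVec v) 0; (N.mulVec v) 2, -(N.mulVec v) 1] * gm := by
    rw [X_decomp v, X_mulVec_decomp N v, ← he₀, ← he₁, ← he₂, ← hE, ← hH, ← hF, ← hE', ← hH',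
      ← hF']
    simp only [Matrix.mul_add, Matrix.add_mul, Matrix.mul_smul, Matrix.smul_mul, hgE, hgF, hgH]
  have hunit : IsUnit gm.det := (isUnit_iff_ne_zero).mpr hdetg
  rw [Matrix.coe_units_inv]
  change gm * !![v 1, v 0; v 2, -v 1] * gm⁻¹ = _
  rw [hcomm, Matrix.mul_nonsing_inv_cancel_right _ _ hunit]

/-- The bilinear form `x ⬝ (A y)` of a symmetric matrix is symmetric. -/
private theorem toLinearMap₂'_symm_of_isSymm {A : Matrix (Fin 3) (Fin 3) k} (hA : A.IsSymm)
    (x y : Fin 3 → k) : Matrix.toLinearMap₂' k A x y = Matrix.toLinearMap₂' k A y x := by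
  rw [Matrix.toLinearMap₂'_apply', Matrix.toLinearMap₂'_apply', Matrix.dotProduct_mulVec,
    ← Matrix.mulVec_transpose, hA.eq, dotProduct_comm]

/-- **Congruence of nondegenerate symmetric matrices over an algebraically closed field** (`2 ≠ 0`):
`Tᵀ A T = B` for some invertible `T` (Mathlib's `QuadraticForm.equivalent_of_isAlgClosed`, read in
matrices). -/
theorem exists_transpose_mul_mul_eq_of_isSymm [IsAlgClosed k] (h2 : (2 : k) ≠ 0)
    (A B : Matrix (Fin 3) (Fin 3) k) (hA : A.IsSymm) (hAdet : A.det ≠ 0) (hB : B.IsSymm)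
    (hBdet : B.det ≠ 0) :
    ∃ T : GL (Fin 3) k,
      (T : Matrix (Fin 3) (Fin 3) k).transpose * A * (T : Matrix (Fin 3) (Fin 3) k) = B := by
  haveI : Invertible (2 : k) := invertibleOfNonzero h2
  set QA : QuadraticForm k (Fin 3 → k) := A.toQuadraticForm' with hQA
  set QB : QuadraticForm k (Fin 3 → k) := B.toQuadraticForm' with hQB
  have hassA : QuadraticMap.associated QA = Matrix.toLinearMap₂' k A :=
    QuadraticMap.associated_left_inverse _ (toLinearMap₂'_symm_of_isSymm hA)
  have hassB : QuadraticMap.associated QB = Matrix.toLinearMap₂' k B :=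
    QuadraticMap.associated_left_inverse _ (toLinearMap₂'_symm_of_isSymm hB)
  have hsepA : (QuadraticMap.associated QA).SeparatingLeft := by
    rw [hassA]; exact LinearMap.separatingLeft_toLinearMap₂'_iff_det_ne_zero.mpr hAdet
  have hsepB : (QuadraticMap.associated QB).SeparatingLeft := by
    rw [hassB]; exact LinearMap.separatingLeft_toLinearMap₂'_iff_det_ne_zero.mpr hBdet
  obtain ⟨f⟩ := QuadraticForm.equivalent_of_isAlgClosed QB QA hsepB hsepA
  -- `f : QB ≅ QA`, i.e. `QA (f x) = QB x`, so `QB = QA.comp f`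
  have hcomp : QB = QA.comp (f : (Fin 3 → k) →ₗ[k] (Fin 3 → k)) := by
    ext x
    exact (f.map_app x).symm
  have hmatA : QA.toMatrix' = A := by
    rw [QuadraticForm.toMatrix', hassA, LinearMap.toMatrix'_toLinearMap₂']
  have hmatB : QB.toMatrix' = B := by
    rw [QuadraticForm.toMatrix', hassB, LinearMap.toMatrix'_toLinearMap₂']
  set Fm : Matrix (Fin 3) (Fin 3) k := LinearMap.toMatrix' (f : (Fin 3 → k) →ₗ[k] (Fin 3 → k))
    with hFm
  have hkey : Fm.transpose * A * Fm = B := by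
    rw [← hmatA, ← hmatB, hcomp, QuadraticForm.toMatrix'_comp]
  have hFdet : Fm.det ≠ 0 := by
    intro h0
    apply hBdet
    rw [← hkey, Matrix.det_mul, h0, mul_zero]
  exact ⟨Matrix.GeneralLinearGroup.mkOfDetNeZero Fm hFdet, hkey⟩

end SplitSO3

/-- **STUB C — the exceptional isomorphism `SO₃ = Ad(GL₂)` (surjectivity), with the split model.**
Over an algebraically closed field `k` with `2 ≠ 0`, a symmetric invertible `3 × 3` matrix `A` is
congruent to the Gram matrix `J = !![0,0,1;0,2,0;1,0,0]` of the trace form of `sl₂` in the basis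
`E, H, F` (`Tᵀ A T = J`), and then every `M` with `Mᵀ A M = A`, `det M = 1` acts on `sl₂`, in the
coordinates `v ↦ X_v = !![v 1, v 0; v 2, -v 1]` transported by `T`, as conjugation by some
`g ∈ GL₂(k)`: `g X_v g⁻¹ = X_{(T⁻¹ M T) v}` (`exists_transpose_mul_mul_eq_of_isSymm`, then
`exists_conj_eq_of_mem_SO` for `N := T⁻¹ M T ∈ SO(J)`). [cite: SerreDurham1977, §6.1] [folklore] -/
theorem stub_adSurjectiveOfSplitForm {k : Type} [Field k] [IsAlgClosed k] (h2 : (2 : k) ≠ 0)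
    (A : Matrix (Fin 3) (Fin 3) k) (hsymm : A.IsSymm) (hdet : A.det ≠ 0) :
    ∃ T : GL (Fin 3) k,
      (T : Matrix (Fin 3) (Fin 3) k).transpose * A * (T : Matrix (Fin 3) (Fin 3) k) =
        !![0, 0, 1; 0, 2, 0; 1, 0, 0] ∧
      ∀ M : Matrix (Fin 3) (Fin 3) k, M.transpose * A * M = A → M.det = 1 →
        ∃ g : GL (Fin 2) k, ∀ v w : Fin 3 → k,
          w = (((T⁻¹ : GL (Fin 3) k) : Matrix (Fin 3) (Fin 3) k) * M *
            (T : Matrix (Fin 3) (Fin 3) k)).mulVec v →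
          (g : Matrix (Fin 2) (Fin 2) k) * !![v 1, v 0; v 2, -v 1] *
              ((g⁻¹ : GL (Fin 2) k) : Matrix (Fin 2) (Fin 2) k) =
            !![w 1, w 0; w 2, -w 1] := by
  have hJsymm : (!![0, 0, 1; 0, 2, 0; 1, 0, 0] : Matrix (Fin 3) (Fin 3) k).IsSymm := by
    unfold Matrix.IsSymm
    ext i j; fin_cases i <;> fin_cases j <;> rfl
  have hJdet : (!![0, 0, 1; 0, 2, 0; 1, 0, 0] : Matrix (Fin 3) (Fin 3) k).det ≠ 0 :=
    det_J (k := k) ▸ neg_ne_zero.mpr h2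
  obtain ⟨T, hT⟩ := exists_transpose_mul_mul_eq_of_isSymm h2 A _ hsymm hdet hJsymm hJdet
  refine ⟨T, hT, fun M hM hMdet => ?_⟩
  -- `N := T⁻¹ M T ∈ SO(J)`
  set Tm : Matrix (Fin 3) (Fin 3) k := (T : Matrix (Fin 3) (Fin 3) k) with hTm
  set Ti : Matrix (Fin 3) (Fin 3) k := ((T⁻¹ : GL (Fin 3) k) : Matrix (Fin 3) (Fin 3) k) with hTi
  have hTiT : Ti * Tm = 1 := by
    rw [hTi, hTm, ← Units.val_mul, inv_mul_cancel, Units.val_one]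
  have hTTi : Tm * Ti = 1 := by
    rw [hTi, hTm, ← Units.val_mul, mul_inv_cancel, Units.val_one]
  set N : Matrix (Fin 3) (Fin 3) k := Ti * M * Tm with hN
  have hA' : A = Ti.transpose * !![0, 0, 1; 0, 2, 0; 1, 0, 0] * Ti := by
    rw [← hT]
    calc A = (Tm * Ti).transpose * A * (Tm * Ti) := by rw [hTTi, Matrix.transpose_one,
          Matrix.one_mul, Matrix.mul_one]
      _ = Ti.transpose * (Tm.transpose * A * Tm) * Ti := by
          rw [Matrix.transpose_mul]; simp only [Matrix.mul_assoc]
  have hNJ : N.transpose * !![0, 0, 1; 0, 2, 0; 1, 0, 0] * N = !![0, 0, 1; 0, 2, 0; 1, 0, 0] := by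
    calc N.transpose * !![0, 0, 1; 0, 2, 0; 1, 0, 0] * N
        = Tm.transpose * M.transpose * (Ti.transpose * !![0, 0, 1; 0, 2, 0; 1, 0, 0] * Ti) * M *
            Tm := by
          rw [hN, Matrix.transpose_mul, Matrix.transpose_mul]; simp only [Matrix.mul_assoc]
      _ = Tm.transpose * (M.transpose * A * M) * Tm := by rw [← hA']; simp only [Matrix.mul_assoc]
      _ = !![0, 0, 1; 0, 2, 0; 1, 0, 0] := by rw [hM, hT]
  have hNdet : N.det = 1 := by
    rw [hN, Matrix.det_mul, Matrix.det_mul, hMdet, mul_one, ← Matrix.det_mul, hTiT, Matrix.det_one]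
  obtain ⟨g, hg⟩ := exists_conj_eq_of_mem_SO h2 hNJ hNdet
  refine ⟨g, fun v w hw => ?_⟩
  rw [hg v, hw]

end Summit.Langlands.Langlands.Cruxes.AdjointSeedFromDuality.Birth
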